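import Summits.QuantumFields.BalabanUV.Beta.FP.TowerK2bDoorReadoutColumn
import Summits.QuantumFields.BalabanUV.Beta.FP.TowerK2bDoorReadoutPeriodised

/-!
# `BalabanUV.Beta.FP.TowerK2bDoorReadoutTorus` — binder row D1, the row's ONE file: **(C) AND (R) SURVIVE PERIODISATION — the torus read-out weight of (T2)
# is co-closed in the response slot and mirror-even off the mirror axis, on EVERY box** (K2L-M2P7's two EXACT observations at p = 7 — `wPhi9` co-closed to 8.6e−15,
# mirror-covariant to 1.4e−15 — as theorems at the torus letter `Ŝ` of v10's `hWΔT`; PART 46 = the lattice column, PART 47 = the periodisation)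
# (β-function cell `pub-balaban`, BINDER-OWNERS row D1 ∕ (C1) OWNER «beta-an2» gen 76, PART 48)

WHY (located; J-NOTE-20 §3; SPEC-64 §12 (4)(ε), PREDICTION-AN2-75-Z (c): «`Ŝ` co-closed and reflection-even EXACTLY ⇒ `M0Ŝ = M1Ŝ = 0`»).  PART 47 `perF_AN_inr_inr_eq_tsum_wΦ` writes the
(T2) read-out weight `perF T (AN R j) (wrapPt T (L•β), inr κ) (wrapPt T (L•z), inr ν)` (`T = Lc^(j+1) • M′`) as the translate sum `Σ'_m wΦ κ ν (β − translate M′ z m)`; the summand family is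
summable (lit `absMoment₂_wΦ` ⟹ `Summable`, pulled back along the injective `m ↦ β − translate M′ z m`), so PART 46's pointwise identities pass through the sum: (C) `Σ_κ` of backward differences
commutes with `Σ'_m` (`tsum_sub`, `tsum_finset`-free: `Summable.tsum_finsetSum`), (R) the mirror `ε_ρ` re-indexes the translate lattice (`ε(translate M′ 0 m) = translate M′ 0 (εm)`) at the source `z = 0`.

WHAT ([folklore] `tsum` bookkeeping BY NAME; no `def`, nothing cited, 0 sorry; `d = 3`, any `R : Roots Lc`, `j`, `T = Lc^(j+1) • M′`):
§1 `summable_wΦ_sub_translate` (the summand family of PART 47 is summable); §2 (C) **`sum_tsum_wΦ_sub_translate_backward_eq_zero`** (`Σ_κ (Σ'_m wΦ κ ν (β − M′m − z) − Σ'_m wΦ κ ν (β − e_κ − M′m − z)) = 0`)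
and at the torus letter **`sum_perF_AN_inr_inr_backward_eq_zero`**: `Σ_κ (perF T (AN R j) (wrapPt T (L•β), inr κ) q − perF T (AN R j) (wrapPt T (L•(β − e_κ)), inr κ) q) = 0` for the source slot
`q = (wrapPt T (L•z), inr ν)`; §3 (R) `axisReflect_translate_zero` (`ε(translate M′ 0 m) = translate M′ 0 (εm)`), **`tsum_wΦ_axisReflect_translate_of_ne`**, and at the torus letter
**`perF_AN_inr_inr_axisReflect_of_ne`**: for `κ, ν ≠ ρ`, `perF T (AN R j) (wrapPt T (L•εβ), inr κ) (wrapPt T 0, inr ν) = perF T (AN R j) (wrapPt T (L•β), inr κ) (wrapPt T 0, inr ν)`.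
WHAT THIS IS NOT: not (T2), not (X), not the torus MOMENTS `M0Ŝ ∕ M1Ŝ` (PART 42∕44 turn (C)(R) into those on the lattice; the torus product's containment is a by-value matter, SPEC-64 §12); nothing of
Bałaban's asserted, valued or discharged; 0 estimates; 0∕4 row-D1 binders (hW, hR, D1Tel, D1Rep); v10 NOT filed; v9 p617999 stands; NOT (C1), NOT (T-ID), NOT D1, NEVER «G-an2-4 closed», NOT BetaPertH, NOT continuum, NOT Clay.

HONEST DEPENDENCY (page 1, mandatory): continuum YM on T⁴ ⇐ BetaPertH ∧ nine spine estimates (0/9 proved); BetaPertH ⇐ (D1) ∧ (D4) ∧ CAP+tail;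
G-an2-4 gates asym, D1 and NE2/3/4.  HONEST FRAMING (cell contract, verbatim): «discharging `BetaPertH` makes Bałaban's UV stability UNCONDITIONAL —
a real constructive-QFT result; it is NOT the continuum limit and NOT the Clay problem.»  ABSOLUTE RULE (cell charter, verbatim): «No internally-minted
statement may enter as a cited fact. Every hypothesis is either kernel-proved in this package or a verbatim quotation of a PUBLISHED theorem with page
reference. The manuscript(s) under audit are NOT citable for their own disputed steps — they are the thing under adjudication; programme-internal
(2001/route/tribunal) claims are never citable.»  Row D1 ∕ (C1) OWNER «beta-an2» gen 76, 2026-08-29.  No existing file touched.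
-/

noncomputable section

open Finset
open scoped BigOperators
open Literature.MathematicalPhysics.QuantumFieldTheory
open Literature.MathematicalPhysics.QuantumFieldTheory.Balaban1983to89
open Literature.MathematicalPhysics.QuantumFieldTheory.Balaban1983to89.Beta
open B4TorusKernel.MultiPeriod (translate translate_injective)
open B6BondElimination (unitVec unitVec_apply)
open B6Lemma24Torus (pbox)
open PolarizationSign (axisReflect axisReflect_apply axisReflect_axisReflect)
open AffineAveraging (Site)
open KernelSpecInstance (wΦ absMoment₂_wΦ)
open DecimatedMomentSummable (summable_of_absMoment₂)
open Summit.QuantumFields.BalabanUV.Beta.CompositeOneShotJetData (Roots AN)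
open Summit.QuantumFields.BalabanUV.Beta.FP.KernelPeriodisationFib (perF)
open Summit.QuantumFields.BalabanUV.Beta.FP.TorusGaugeCovariancePairing (wrapPt)
open Summit.QuantumFields.BalabanUV.Beta.FP.TowerK2bDoorReadoutColumn (sum_wΦ_sub_sub_eq_zero wΦ_axisReflect_of_ne)
open Summit.QuantumFields.BalabanUV.Beta.FP.TowerK2bDoorReadoutPeriodised (perF_AN_inr_inr_eq_tsum_wΦ_sub perF_AN_inr_inr_eq_tsum_wΦ)

namespace Summit.QuantumFields.BalabanUV.Beta.FP.TowerK2bDoorReadoutTorus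

/-! ## §1 The translate family of the read-out column is summable -/

section Summable

variable {N : ℕ} [NeZero N]

/-- [folklore] `m ↦ wΦ κ ν (c − translate M′ 0 m)` is summable for every offset `c` (lit `absMoment₂_wΦ` ⟹ `Summable`, pulled back along the injective translate map; `M′ i ≥ 1`). -/
theorem summable_wΦ_sub_translate (M' : Fin (3 + 1) → ℕ) [∀ i, NeZero (M' i)] (κ ν : Fin (3 + 1)) (c : Site (3 + 1)) :
    Summable (fun m : Site (3 + 1) => wΦ (N := N) κ ν (c - translate M' 0 m)) := by
  have hs : Summable (wΦ (N := N) κ ν) := summable_of_absMoment₂ (absMoment₂_wΦ (N := N) κ ν)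
  have hinj : Function.Injective (fun m : Site (3 + 1) => c - translate M' 0 m) := by
    intro m m' h
    exact translate_injective (fun i => Nat.one_le_iff_ne_zero.mpr (NeZero.ne (M' i))) 0 (sub_right_injective h)
  exact hs.comp_injective hinj

end Summable

/-! ## §2 (C) survives periodisation -/

section Coclosed

variable {N : ℕ} [NeZero N]

/-- [folklore] **(C) FOR THE PERIODISED COLUMN**: `Σ_κ (Σ'_m wΦ κ ν (β − z − M′m) − Σ'_m wΦ κ ν (β − e_κ − z − M′m)) = 0`
(PART 46 `sum_wΦ_sub_sub_eq_zero` under the translate sum; `tsum_sub`, `Summable.tsum_finsetSum`). -/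
theorem sum_tsum_wΦ_sub_translate_backward_eq_zero (M' : Fin (3 + 1) → ℕ) [∀ i, NeZero (M' i)] (ν : Fin (3 + 1)) (β z : Site (3 + 1)) :
    ∑ κ : Fin (3 + 1), ((∑' m : Site (3 + 1), wΦ (N := N) κ ν (β - z - translate M' 0 m))
        - ∑' m : Site (3 + 1), wΦ (N := N) κ ν (β - unitVec κ - z - translate M' 0 m)) = 0 := by
  have hs : ∀ κ : Fin (3 + 1), Summable (fun m : Site (3 + 1) => wΦ (N := N) κ ν (β - z - translate M' 0 m)) :=
    fun κ => summable_wΦ_sub_translate (N := N) M' κ ν (β - z)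
  have hs' : ∀ κ : Fin (3 + 1), Summable (fun m : Site (3 + 1) => wΦ (N := N) κ ν (β - unitVec κ - z - translate M' 0 m)) :=
    fun κ => summable_wΦ_sub_translate (N := N) M' κ ν (β - unitVec κ - z)
  calc ∑ κ : Fin (3 + 1), ((∑' m : Site (3 + 1), wΦ (N := N) κ ν (β - z - translate M' 0 m))
          - ∑' m : Site (3 + 1), wΦ (N := N) κ ν (β - unitVec κ - z - translate M' 0 m))
      = ∑ κ : Fin (3 + 1), ∑' m : Site (3 + 1),
          (wΦ (N := N) κ ν (β - z - translate M' 0 m) - wΦ (N := N) κ ν (β - unitVec κ - z - translate M' 0 m)) :=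
        Finset.sum_congr rfl fun κ _ => ((hs κ).tsum_sub (hs' κ)).symm
    _ = ∑' m : Site (3 + 1), ∑ κ : Fin (3 + 1),
          (wΦ (N := N) κ ν (β - z - translate M' 0 m) - wΦ (N := N) κ ν (β - unitVec κ - z - translate M' 0 m)) :=
        (Summable.tsum_finsetSum (fun κ _ => (hs κ).sub (hs' κ))).symm
    _ = ∑' _m : Site (3 + 1), (0 : ℝ) := by
        refine tsum_congr fun m => ?_
        have h := sum_wΦ_sub_sub_eq_zero (N := N) ν β (z + translate M' 0 m)
        have e1 : β - (z + translate M' 0 m) = β - z - translate M' 0 m := by abel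
        have e2 : ∀ κ : Fin (3 + 1), β - unitVec κ - (z + translate M' 0 m) = β - unitVec κ - z - translate M' 0 m :=
          fun κ => by abel
        simp_rw [e1, e2] at h
        exact h
    _ = 0 := tsum_zero

variable {Lc : ℕ} [NeZero Lc] (R : Roots Lc) (j : ℕ)

/-- [folklore] **(C) AT THE TORUS LETTER OF (T2)**: for every torus `T = Lc^(j+1) • M′` and source slot `(wrapPt T (L•z), inr ν)`,
`Σ_κ (perF T (AN R j) (wrapPt T (L•β), inr κ) q − perF T (AN R j) (wrapPt T (L•(β − e_κ)), inr κ) q) = 0` — the periodised read-out weight is co-closed in the response slot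
(PART 47 `perF_AN_inr_inr_eq_tsum_wΦ_sub` + §2). -/
theorem sum_perF_AN_inr_inr_backward_eq_zero (T M' : Fin (3 + 1) → ℕ) [∀ i, NeZero (T i)] [∀ i, NeZero (M' i)] (hT : ∀ i, T i = Lc ^ (j + 1) * M' i)
    (ν : Fin (3 + 1)) (β z : Site (3 + 1)) :
    ∑ κ : Fin (3 + 1), (perF T (AN R j) (wrapPt T (((Lc ^ (j + 1) : ℕ) : ℤ) • β), Sum.inr κ) (wrapPt T (((Lc ^ (j + 1) : ℕ) : ℤ) • z), Sum.inr ν)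
        - perF T (AN R j) (wrapPt T (((Lc ^ (j + 1) : ℕ) : ℤ) • (β - unitVec κ)), Sum.inr κ) (wrapPt T (((Lc ^ (j + 1) : ℕ) : ℤ) • z), Sum.inr ν)) = 0 := by
  simp_rw [perF_AN_inr_inr_eq_tsum_wΦ_sub R j T M' hT]
  exact sum_tsum_wΦ_sub_translate_backward_eq_zero (N := Lc ^ (j + 1)) M' ν β z

end Coclosed

/-! ## §3 (R) survives periodisation (source at the mirror-fixed slot `z = 0`) -/

section Mirror

/-- [folklore] the coordinate mirror commutes with translating the origin: `ε(translate M′ 0 m) = translate M′ 0 (εm)`. -/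
theorem axisReflect_translate_zero (M' : Fin (3 + 1) → ℕ) (ρ : Fin (3 + 1)) (m : Site (3 + 1)) :
    axisReflect ρ (translate M' 0 m) = translate M' 0 (axisReflect ρ m) := by
  funext i
  simp only [axisReflect_apply, B4TorusKernel.MultiPeriod.translate_apply, Pi.zero_apply, zero_add]
  split_ifs <;> ring

variable {N : ℕ} [NeZero N]

/-- [folklore] **(R) FOR THE PERIODISED COLUMN AT THE SOURCE `0`**: for `κ, ν ≠ ρ`, `Σ'_m wΦ κ ν (εβ − translate M′ 0 m) = Σ'_m wΦ κ ν (β − translate M′ 0 m)`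
(re-index `m ↦ εm` by `Equiv.tsum_eq`, §3's commutation, PART 46 `wΦ_axisReflect_of_ne`). -/
theorem tsum_wΦ_axisReflect_translate_of_ne (M' : Fin (3 + 1) → ℕ) {ρ κ ν : Fin (3 + 1)} (hκ : κ ≠ ρ) (hν : ν ≠ ρ) (β : Site (3 + 1)) :
    ∑' m : Site (3 + 1), wΦ (N := N) κ ν (axisReflect ρ β - translate M' 0 m)
      = ∑' m : Site (3 + 1), wΦ (N := N) κ ν (β - translate M' 0 m) := by
  rw [← (Function.Involutive.toPerm (axisReflect ρ) (axisReflect_axisReflect ρ)).tsum_eq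
    (fun m : Site (3 + 1) => wΦ (N := N) κ ν (axisReflect ρ β - translate M' 0 m))]
  refine tsum_congr fun m => ?_
  have e : axisReflect ρ β - translate M' 0 (axisReflect ρ m) = axisReflect ρ (β - translate M' 0 m) := by
    rw [← axisReflect_translate_zero]
    funext i
    simp only [Pi.sub_apply, axisReflect_apply]
    split_ifs <;> ring
  simp only [Function.Involutive.coe_toPerm]
  rw [e, wΦ_axisReflect_of_ne (N := N) hκ hν]

variable {Lc : ℕ} [NeZero Lc] (R : Roots Lc) (j : ℕ)

/-- [folklore] **(R) AT THE TORUS LETTER OF (T2), SOURCE AT THE ORIGIN**: for every torus `T = Lc^(j+1) • M′` and `κ, ν ≠ ρ`,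
`perF T (AN R j) (wrapPt T (L•εβ), inr κ) (wrapPt T (L•0), inr ν) = perF T (AN R j) (wrapPt T (L•β), inr κ) (wrapPt T (L•0), inr ν)` (PART 47 + §3). -/
theorem perF_AN_inr_inr_axisReflect_of_ne (T M' : Fin (3 + 1) → ℕ) [∀ i, NeZero (T i)] (hT : ∀ i, T i = Lc ^ (j + 1) * M' i)
    {ρ κ ν : Fin (3 + 1)} (hκ : κ ≠ ρ) (hν : ν ≠ ρ) (β : Site (3 + 1)) :
    perF T (AN R j) (wrapPt T (((Lc ^ (j + 1) : ℕ) : ℤ) • axisReflect ρ β), Sum.inr κ) (wrapPt T (((Lc ^ (j + 1) : ℕ) : ℤ) • (0 : Site (3 + 1))), Sum.inr ν)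
      = perF T (AN R j) (wrapPt T (((Lc ^ (j + 1) : ℕ) : ℤ) • β), Sum.inr κ) (wrapPt T (((Lc ^ (j + 1) : ℕ) : ℤ) • (0 : Site (3 + 1))), Sum.inr ν) := by
  rw [perF_AN_inr_inr_eq_tsum_wΦ R j T M' hT, perF_AN_inr_inr_eq_tsum_wΦ R j T M' hT]
  exact tsum_wΦ_axisReflect_translate_of_ne (N := Lc ^ (j + 1)) M' hκ hν β

end Mirror

end Summit.QuantumFields.BalabanUV.Beta.FP.TowerK2bDoorReadoutTorus

end
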